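/-
Copyright (c) 2026 the pub-hodgecm-mathlib formalisation cell (harness21).  Prover seat hodgecm-mathlib-K2Liu-p05 (g4), 2026-09-04
(Track B «K2-LIT», crux hLiu418 = stmt-HodgeConjecture-24832, socket #42F′, ROAD I v3, organ G2-Weil, bridge (G2-W4) part W4-ii (χ-pinning):
the factor character of the archimedean one-place factorisation is TRIVIAL on `U(P′,Q′) × 1`).
-/
import Summits.HodgeConjecture.HodgeConjecture.Theorems.K2LiuArchSectionPlaceJunction        -- ★ p858444 (W4-i junction): `exists_circle_twist_factorisation_placeSecJ`
import Literature.RepresentationTheory.KonnoKonno2007.RealUnitaryKAK                          -- ★ `UForm.hom_eq_one_of_forall_kV` (a `K`-trivial character of `U(α,β)` is trivial)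
import Literature.NumberTheory.Weil1964.ArchUnitaryWeilHalfCompact                            -- ★ `vac_archWeilSectionS_of_kV`, `reindexUnitary`
import Literature.NumberTheory.Weil1964.ArchMetaplecticTensor                                 -- ★ `hermitePi_zero_eq_tensorPi`
import Literature.Analysis.SegalBargmann.SchrodingerCompactRigidity                           -- ★ `inner_vacL2_self`
import HarnessLib

/-!
# (G2-W4-ii, χ-pinning) The factor character of the archimedean section at a real place is trivial on `U(P′,Q′) × 1`:
# `s_∞(placeSecJ σ (g, 1)) (Φ₁ ⊠ Φ₂) = (weilRepPair (g, 1) Φ₁) ⊠ Φ₂` — NO twist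

Track B ∕ K2-LIT, hLiu418 = stmt-HodgeConjecture-24832, #42F′ ROAD I v3 organ G2-Weil, bridge (G2-W4) (LEAD F0P6-plan (g12) RULING M-156j; HANDOFF v26 deal
«p05 (g4) item (2): χ-pinning ⇒ the explicit `hasDerivAt_swSection_arch_orbit … 0`»).  Namespace
`Summit.HodgeConjecture.HodgeConjecture.Cruxes.HLiu418.K2LiuArchSectionPlaceBlock` (continued).  THEOREMS ONLY (no definition, no instance, no notation,
no named fact, no `sorry`); `--supports stmt-HodgeConjecture-24832 --as helper`.

(W4-i) ★ `exists_circle_twist_factorisation_placeSecJ` factorises Folland's `det^{1/2}`-normalised section of the whole archimedean group `U(J)(F ⊗ ℝ)`,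
read in the junction frame at a real place `σ` (`archSectionRepJ`), along the one-place section `placeSecJ σ : U(P′,Q′) × U(1,0) →* U(J)(F ⊗ ℝ)`:
`archSectionRepJ (placeSecJ σ u) (Φ₁ ⊠ Φ₂) = ((χ ⊗ weilRepPair) u Φ₁) ⊠ Φ₂` for SOME continuous circle character `χ`.  THIS FILE PINS `χ` ON THE FIRST MEMBER:
**`χ (g, 1) = 1` for every `g ∈ U(P′,Q′)`**, at every signature `(P′, Q′)` — both sides are `det^{−1/2}`-normalised in the SAME way:
* §1 frame lemmas: `(UForm.relabel eP eQ)⁻¹ (kV (k₁, k₂)) = kV (k₁^{eP}, k₂^{eQ})` (`relabel_symm_kV`), hence the place components of `placeSecJ σ (kV k, 1)` are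
  sign-block compact — `kV (k₁^{eP}, k₂^{eQ})` at `σ`, `1 = kV (1,1)` elsewhere (`archUFormPi_placeSecJ_kV`) — and **Folland's vacuum coefficient there is
  `(det k₂)⁻¹`** (`vac_archWeilSectionS_placeSecJ_kV`, ★ `vac_archWeilSectionS_of_kV`);
* §2 on the junction side the vacuum of `weilRepPair = weilRep ∘ toBig` is a `K`-eigenvector with eigencharacter `vacScalar ⟨0, −1, −|Q′|, −|P′|⟩` (★
  `weilRepPair_κ_hermitePi_zero` = [KonnoKonno2007, Lemma 5.2]), which at `κ (k, 1)` is `(det k₂)⁻¹` (`vacScalar_junction_mk_one`); reading the factorisation at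
  the Gaussian `h₀ = h₀ ⊠ h₀` (★ `hermitePi_zero_eq_tensorPi`; the index transports fix `h₀`, ★ `schwartzTransport_reindexCLE_symm_hermitePi_zero`) gives
  `s_∞(placeSecJ σ (kV k, 1)) h₀ = χ(kV k, 1) · (det k₂)⁻¹ · h₀` (`archWeilSectionS_placeSecJ_kV_hermitePi_zero`), so `vac = χ(kV k,1) · (det k₂)⁻¹` (★ `MpS.vac_apply`,
  ★ `inner_vacL2_self`) and **`χ (kV k, 1) = 1`** (`factorChar_kV_eq_one`);
* §3 a character of `U(P′,Q′)` trivial on `K = U(P′) × U(Q′)` is trivial (★ `UForm.hom_eq_one_of_forall_kV`, the `KAK` decomposition), so `χ ∘ inl = 1` and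
  **`archSectionRepJ_placeSecJ_inl_tensorPi`**: `archSectionRepJ (placeSecJ σ (g, 1)) (Φ₁ ⊠ Φ₂) = (weilRepPair (g, 1) Φ₁) ⊠ Φ₂` for ALL `g`, `Φ₁`, `Φ₂` — the
  hypothesis-free junction datum ★ `isArchWeilDatum_weilRepPair` IS the `σ`-component of Folland's section, with no twist.
Consequence for W4-ii (sequel `K2LiuSwSectionArchOrbitDeriv`): the derivative vectors of `t ↦ f_{a ⊗ f}(h · placeSecJ σ (exp tY, 1))` are the EXPLICIT letter
derivatives of ★ `K2LiuWeilRepPairSmoothU22` ∕ ★ `hasDerivAt_weilDatum_expMem_smul'` at `ω = weilRepPair`, plus the `η_t`-term.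

HONEST LABEL: HC_CM is proved only modulo the 7 printed citations (2 remaining named inputs: hLiu418 = stmt-HodgeConjecture-24832, h413 =
stmt-HodgeConjecture-24833) until rung 0 closes; organ capital for #42F′'s Road I, moves no counter.

## References
[Folland1989] G. B. Folland, *Harmonic Analysis in Phase Space* (1989), Prop. (1.43), §4.2 (4.23), (4.30)–(4.36), Prop. (4.39) · [KonnoKonno2007] K. Konno,
T. Konno, Kyushu J. Math. 61 (2007), §3.1 (3.1), Lemma 5.2 p. 73 · [Knapp2002] A. W. Knapp, *Lie Groups Beyond an Introduction* (2002), Thm. 7.39 ·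
[Paul1998] A. Paul, J. Funct. Anal. 159 (1998), §1.2 (1.2.2) · [Weil1964] A. Weil, Acta Math. 111 (1964), Chap. I n° 12, Chap. III n° 37–38.
-/

set_option autoImplicit false
set_option linter.dupNamespace false

noncomputable section

open scoped Matrix Classical InnerProductSpace
open MeasureTheory
open NumberField NumberField.InfinitePlace NumberField.mixedEmbedding
open Literature.NumberTheory.Automorphic Literature.NumberTheory.Automorphic.UnitaryGroup
open Literature.RepresentationTheory.HeisenbergGroup Literature.Analysis.SegalBargmann
open Literature.RepresentationTheory.KonnoKonno2007 hiding LetterKind letterOf letterGen letterOf_boost letterOf_torus letterOf_torus_eq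
  letterGen_boost letterGen_torus letterGen_mem_lie exp_smul_letterGen
open Literature.RepresentationTheory.KonnoKonno2007.RealDualPair
open Literature.NumberTheory.Weil1964 Literature.NumberTheory.Weil1964.MpS Literature.NumberTheory.Weil1964.UnitaryWeil

namespace Summit.HodgeConjecture.HodgeConjecture.Cruxes.HLiu418.K2LiuArchSectionPlaceBlock

/-! ## §1 The place components of `placeSecJ σ (kV k, 1)` and Folland's vacuum coefficient there -/

section Relabel

variable {α β α' β' : Type} [Fintype α] [DecidableEq α] [Fintype β] [DecidableEq β]
  [Fintype α'] [DecidableEq α'] [Fintype β'] [DecidableEq β']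

/-- **relabelling a sign-block compact element**: `relabel e₁ e₂ (kV (k₁^{e₁}, k₂^{e₂})) = kV (k₁, k₂)`, `k^{e} = reindexUnitary e k` (★ `UForm.coe_relabel`,
★ `UForm.coe_kV`, ★ `reindexUnitary_apply`). [cite: KonnoKonno2007, §3.1 (3.1)] -/
theorem relabel_kV_reindexUnitary (e₁ : α ≃ α') (e₂ : β ≃ β') (k : Matrix.unitaryGroup α' ℂ × Matrix.unitaryGroup β' ℂ) :
    UForm.relabel α β α' β' e₁ e₂ (UForm.kV α β (reindexUnitary e₁ k.1, reindexUnitary e₂ k.2)) = UForm.kV α' β' k := by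
  refine Subtype.ext (Units.ext ?_)
  rw [UForm.coe_relabel, UForm.coe_kV, UForm.coe_kV]
  ext i j
  rcases i with i | i <;> rcases j with j | j <;>
    simp only [Matrix.reindex_apply, Matrix.submatrix_apply, Equiv.sumCongr_symm, Equiv.sumCongr_apply, Sum.map_inl, Sum.map_inr,
      Matrix.fromBlocks_apply₁₁, Matrix.fromBlocks_apply₁₂, Matrix.fromBlocks_apply₂₁, Matrix.fromBlocks_apply₂₂, reindexUnitary_apply,
      Equiv.apply_symm_apply, Matrix.zero_apply]

/-- … read backwards: `(relabel e₁ e₂)⁻¹ (kV (k₁, k₂)) = kV (k₁^{e₁}, k₂^{e₂})`. [cite: KonnoKonno2007, §3.1 (3.1)] -/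
theorem relabel_symm_kV (e₁ : α ≃ α') (e₂ : β ≃ β') (k : Matrix.unitaryGroup α' ℂ × Matrix.unitaryGroup β' ℂ) :
    (UForm.relabel α β α' β' e₁ e₂).symm (UForm.kV α' β' k) = UForm.kV α β (reindexUnitary e₁ k.1, reindexUnitary e₂ k.2) := by
  rw [ContinuousMulEquiv.symm_apply_eq, relabel_kV_reindexUnitary]

/-- `det (k^{e}) = det k`. [folklore] -/
theorem det_coe_reindexUnitary {σ σ' : Type*} [Fintype σ] [DecidableEq σ] [Fintype σ'] [DecidableEq σ'] (e : σ ≃ σ')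
    (U : Matrix.unitaryGroup σ' ℂ) :
    ((reindexUnitary e U : Matrix.unitaryGroup σ ℂ) : Matrix σ σ ℂ).det = (U : Matrix σ' σ' ℂ).det :=
  Matrix.det_submatrix_equiv_self e _

end Relabel

section Place

variable {F : Type} [Field F] [NumberField F] (E : Type) [Field E] [NumberField E] [Algebra F E] (c : E ≃ₐ[F] E)
  (N : ℕ) (hc : c ≠ 1)
  (wOf : {v : InfinitePlace F // v.IsReal} → {w : InfinitePlace E // w.IsComplex})
  (hw : ∀ v, c • (wOf v).1 = (wOf v).1) (t₀ : Fin N → F) (ht0 : ∀ j, t₀ j ≠ 0) {δ : E} (hcδ : c δ = -δ) (hδ : δ ≠ 0)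
  (σ : {v : InfinitePlace F // v.IsReal})
  (hover : ∀ v, (wOf v).1.comap (algebraMap F E) = v.1) {T : Matrix (Fin N) (Fin N) F} (hTd : T = Matrix.diagonal t₀)
  {J : Matrix (Fin N) (Fin N) E} (hJ : J = T.map (algebraMap F E)) (hfix : ∀ w : InfinitePlace E, c • w = w)
  {P' Q' : Type} [Fintype P'] [DecidableEq P'] [Fintype Q'] [DecidableEq Q']
  (eP : PosIdx (signVec wOf t₀ δ σ) ≃ P') (eQ : NegIdx (signVec wOf t₀ δ σ) ≃ Q')

/-- **the place components of `placeSecJ σ (kV k, 1)` are sign-block compact**: `kV (k₁^{eP}, k₂^{eQ})` at `σ` and `kV (1, 1)` at every `v ≠ σ`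
(★ `placeSecJ_inl`, §1, ★ `archUFormPi_placeSec`; written with `Function.update 1 σ _` over the place-dependent block types).
[cite: BorelJacquet1979, §4.1] [cite: KonnoKonno2007, §3.1 (3.1)] -/
theorem archUFormPi_placeSecJ_kV (k : Matrix.unitaryGroup P' ℂ × Matrix.unitaryGroup Q' ℂ) (v : {v : InfinitePlace F // v.IsReal}) :
    archUFormPi E c N hc wOf hw hover t₀ ht0 hTd hJ hcδ hδ
        (placeSecJ E c N hc wOf hw t₀ ht0 hcδ hδ σ hover hTd hJ hfix eP eQ ((UForm.kV P' Q' k, (1 : UForm Unit Empty)) : Ginf P' Q' Unit Empty)) v =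
      UForm.kV (PosIdx (signVec wOf t₀ δ v)) (NegIdx (signVec wOf t₀ δ v))
        (Function.update (1 : ∀ v, Matrix.unitaryGroup (PosIdx (signVec wOf t₀ δ v)) ℂ) σ (reindexUnitary eP k.1) v,
         Function.update (1 : ∀ v, Matrix.unitaryGroup (NegIdx (signVec wOf t₀ δ v)) ℂ) σ (reindexUnitary eQ k.2) v) := by
  rw [placeSecJ_inl, archUFormPi_placeSec, relabel_symm_kV]
  by_cases hv : v = σ
  · subst hv
    rw [Pi.mulSingle_eq_same, Function.update_self, Function.update_self]
  · rw [Pi.mulSingle_eq_of_ne hv, Function.update_of_ne hv, Function.update_of_ne hv, Pi.one_apply, Pi.one_apply]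
    exact (map_one (UForm.kV (PosIdx (signVec wOf t₀ δ v)) (NegIdx (signVec wOf t₀ δ v)))).symm

/-- **FOLLAND'S VACUUM COEFFICIENT AT `placeSecJ σ (kV (k₁,k₂), 1)` IS `(det k₂)⁻¹`** (★ `vac_archWeilSectionS_of_kV`: `vac = ∏_v (det b_v)⁻¹` with `b_σ = k₂^{eQ}`, `b_v = 1`
elsewhere). [cite: Folland1989, §4.2 Prop. (4.39)] [cite: Paul1998, §1.2 (1.2.2)] -/
theorem vac_archWeilSectionS_placeSecJ_kV (k : Matrix.unitaryGroup P' ℂ × Matrix.unitaryGroup Q' ℂ) :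
    MpS.vac (archWeilSectionS E c N hc wOf hw hover t₀ ht0 hTd hJ hcδ hδ
        (placeSecJ E c N hc wOf hw t₀ ht0 hcδ hδ σ hover hTd hJ hfix eP eQ ((UForm.kV P' Q' k, (1 : UForm Unit Empty)) : Ginf P' Q' Unit Empty))) =
      ((k.2 : Matrix Q' Q' ℂ).det)⁻¹ := by
  rw [vac_archWeilSectionS_of_kV E c N hc wOf hw hover t₀ ht0 hTd hJ hcδ hδ _ _ _
    (archUFormPi_placeSecJ_kV E c N hc wOf hw t₀ ht0 hcδ hδ σ hover hTd hJ hfix eP eQ k)]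
  congr 1
  rw [Finset.prod_eq_single σ (fun v _ hv => by rw [Function.update_of_ne hv, Pi.one_apply, OneMemClass.coe_one, Matrix.det_one])
    (fun h => absurd (Finset.mem_univ σ) h), Function.update_self, det_coe_reindexUnitary]

/-! ## §2 The junction side: the vacuum eigencharacter at `κ (k, 1)`, and `χ (kV k, 1) = 1` -/

/-- the vacuum eigencharacter of `weilRepPair` on `U(P′,Q′) × U(1,0)` at `κ (k, 1)` is `(det k₂)⁻¹` (★ `vacScalar` with exponents `⟨−|∅|, −|1|, −|Q′|, −|P′|⟩`).
[cite: KonnoKonno2007, Lemma 5.2 p. 73] -/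
theorem vacScalar_junction_mk_one (k : Matrix.unitaryGroup P' ℂ × Matrix.unitaryGroup Q' ℂ) :
    vacScalar (P := P') (Q := Q') (R := Unit) (S := Empty)
        (⟨-(Fintype.card Empty : ℤ), -(Fintype.card Unit : ℤ), -(Fintype.card Q' : ℤ), -(Fintype.card P' : ℤ)⟩ : VacExponents)
        (k, 1) = ((k.2 : Matrix Q' Q' ℂ).det)⁻¹ := by
  simp only [vacScalar, Fintype.card_eq_zero, Fintype.card_unique, Nat.cast_zero, Nat.cast_one, neg_zero, zpow_zero, one_mul,
    Prod.fst_one, Prod.snd_one, OneMemClass.coe_one, Matrix.det_one, one_zpow, inv_one, mul_one, zpow_neg, zpow_one]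

/-- **FOLLAND'S SECTION AT `placeSecJ σ (kV k, 1)` MAPS THE GAUSSIAN TO `χ(kV k, 1) · (det k₂)⁻¹ · h₀`**, for the factor character `χ` of ANY factorisation
`archSectionRepJ (placeSecJ σ u) (Φ₁ ⊠ Φ₂) = ((χ ⊗ weilRepPair) u Φ₁) ⊠ Φ₂` (read at `u = κ (k,1)`, `Φ₁ = Φ₂ = h₀`: ★ `hermitePi_zero_eq_tensorPi`, ★
`weilRepPair_κ_hermitePi_zero`, the index transports fix `h₀`). [cite: Folland1989, Prop. (1.43), §4.2 Prop. (4.39)] [cite: KonnoKonno2007, Lemma 5.2 p. 73] -/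
theorem archWeilSectionS_placeSecJ_kV_hermitePi_zero {χ : Ginf P' Q' Unit Empty →* Circle}
    (hfac : ∀ (u : Ginf P' Q' Unit Empty) (Φ₁ : SchwartzMap (DPIdx P' Q' Unit Empty → ℝ) ℂ)
      (Φ₂ : SchwartzMap ((Fin N × {v : {v : InfinitePlace F // v.IsReal} // v ≠ σ}) → ℝ) ℂ),
      archSectionRepJ E c N hc wOf hw t₀ ht0 hcδ hδ σ hover hTd hJ eP eQ
          (placeSecJ E c N hc wOf hw t₀ ht0 hcδ hδ σ hover hTd hJ hfix eP eQ u) (tensorPi Φ₁ Φ₂) =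
        tensorPi (charTwist (Circle.coeHom.comp χ)
          ((weilRep (α := (P' × Unit) ⊕ (Q' × Empty)) (β := (P' × Empty) ⊕ (Q' × Unit))).comp (toBig P' Q' Unit Empty)) u Φ₁) Φ₂)
    (k : Matrix.unitaryGroup P' ℂ × Matrix.unitaryGroup Q' ℂ) :
    (archWeilSectionS E c N hc wOf hw hover t₀ ht0 hTd hJ hcδ hδ
        (placeSecJ E c N hc wOf hw t₀ ht0 hcδ hδ σ hover hTd hJ hfix eP eQ ((UForm.kV P' Q' k, (1 : UForm Unit Empty)) : Ginf P' Q' Unit Empty))).1.2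
        (hermitePi 0) =
      (((χ ((UForm.kV P' Q' k, (1 : UForm Unit Empty)) : Ginf P' Q' Unit Empty) : Circle) : ℂ) * ((k.2 : Matrix Q' Q' ℂ).det)⁻¹) • hermitePi 0 := by
  have h1 := hfac (κ P' Q' Unit Empty (k, 1)) (hermitePi 0) (hermitePi 0)
  rw [charTwist_apply, weilRepPair_κ_hermitePi_zero, smul_smul, tensorPi_smul_left, ← hermitePi_zero_eq_tensorPi, κ_mk_one,
    MonoidHom.comp_apply, Circle.coeHom_apply, vacScalar_junction_mk_one] at h1
  -- strip the three index transports (they fix `h₀`): `e₃ (e₂ (e₁ X)) = c • h₀` ⇒ `X = c • h₀`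
  simp only [archSectionRepJ, repTransport_apply, MonoidHom.comp_apply, MpS.toEnd_apply, schwartzTransport_reindexCLE_symm_hermitePi_zero] at h1
  have h2 := (ContinuousLinearEquiv.eq_symm_apply _).mpr h1
  simp only [map_smul, schwartzTransport_reindexCLE_symm_hermitePi_zero] at h2
  have h3 := (ContinuousLinearEquiv.eq_symm_apply _).mpr h2
  simp only [map_smul, schwartzTransport_reindexCLE_symm_hermitePi_zero] at h3
  have h4 := (ContinuousLinearEquiv.eq_symm_apply _).mpr h3
  simp only [map_smul, schwartzTransport_reindexCLE_symm_hermitePi_zero] at h4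
  exact h4

/-- **THE FACTOR CHARACTER IS TRIVIAL ON `K × 1`**: `χ (kV k, 1) = 1` for every `k ∈ U(P′) × U(Q′)` — Folland's vacuum coefficient of `s_∞(placeSecJ σ (kV k, 1))` is
`(det k₂)⁻¹` (§1) AND `χ(kV k, 1) · (det k₂)⁻¹` (§2 read through ★ `MpS.vac_apply`, ★ `toL2_hermitePi_zero`, ★ `inner_vacL2_self`).
[cite: Folland1989, §4.2 (4.30)–(4.36), Prop. (4.39)] [cite: KonnoKonno2007, Lemma 5.2 p. 73] -/
theorem factorChar_kV_eq_one {χ : Ginf P' Q' Unit Empty →* Circle}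
    (hfac : ∀ (u : Ginf P' Q' Unit Empty) (Φ₁ : SchwartzMap (DPIdx P' Q' Unit Empty → ℝ) ℂ)
      (Φ₂ : SchwartzMap ((Fin N × {v : {v : InfinitePlace F // v.IsReal} // v ≠ σ}) → ℝ) ℂ),
      archSectionRepJ E c N hc wOf hw t₀ ht0 hcδ hδ σ hover hTd hJ eP eQ
          (placeSecJ E c N hc wOf hw t₀ ht0 hcδ hδ σ hover hTd hJ hfix eP eQ u) (tensorPi Φ₁ Φ₂) =
        tensorPi (charTwist (Circle.coeHom.comp χ)
          ((weilRep (α := (P' × Unit) ⊕ (Q' × Empty)) (β := (P' × Empty) ⊕ (Q' × Unit))).comp (toBig P' Q' Unit Empty)) u Φ₁) Φ₂)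
    (k : Matrix.unitaryGroup P' ℂ × Matrix.unitaryGroup Q' ℂ) :
    χ ((UForm.kV P' Q' k, (1 : UForm Unit Empty)) : Ginf P' Q' Unit Empty) = 1 := by
  have hdet : ((k.2 : Matrix Q' Q' ℂ).det)⁻¹ ≠ 0 :=
    inv_ne_zero (isUnit_iff_ne_zero.mp (Matrix.UnitaryGroup.det_isUnit k.2))
  -- the two computations of Folland's vacuum coefficient
  have hvac := vac_archWeilSectionS_placeSecJ_kV E c N hc wOf hw t₀ ht0 hcδ hδ σ hover hTd hJ hfix eP eQ k
  rw [MpS.vac_apply, archWeilSectionS_placeSecJ_kV_hermitePi_zero E c N hc wOf hw t₀ ht0 hcδ hδ σ hover hTd hJ hfix eP eQ hfac k, map_smul,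
    toL2_hermitePi_zero, inner_smul_right, inner_vacL2_self, mul_one] at hvac
  -- `χ · d⁻¹ = d⁻¹` with `d⁻¹ ≠ 0`
  have hχ : (((χ ((UForm.kV P' Q' k, (1 : UForm Unit Empty)) : Ginf P' Q' Unit Empty) : Circle) : ℂ)) = 1 :=
    mul_left_eq_self₀.mp hvac |>.resolve_right hdet
  exact Circle.coe_eq_one.mp hχ

/-! ## §3 `χ ∘ inl = 1` (KAK), and the pinned factorisation -/

/-- **`χ (g, 1) = 1` FOR EVERY `g ∈ U(P′,Q′)`**: `χ ∘ inl` is a character of `U(P′,Q′)` trivial on `K = U(P′) × U(Q′)` (§2), hence trivial (★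
`UForm.hom_eq_one_of_forall_kV`: `U(P′,Q′) = K A K` and the Weyl trick kill every planar boost). [cite: Knapp2002, Thm. 7.39] [cite: Folland1989, Prop. (4.39)] -/
theorem factorChar_inl_eq_one {χ : Ginf P' Q' Unit Empty →* Circle}
    (hfac : ∀ (u : Ginf P' Q' Unit Empty) (Φ₁ : SchwartzMap (DPIdx P' Q' Unit Empty → ℝ) ℂ)
      (Φ₂ : SchwartzMap ((Fin N × {v : {v : InfinitePlace F // v.IsReal} // v ≠ σ}) → ℝ) ℂ),
      archSectionRepJ E c N hc wOf hw t₀ ht0 hcδ hδ σ hover hTd hJ eP eQ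
          (placeSecJ E c N hc wOf hw t₀ ht0 hcδ hδ σ hover hTd hJ hfix eP eQ u) (tensorPi Φ₁ Φ₂) =
        tensorPi (charTwist (Circle.coeHom.comp χ)
          ((weilRep (α := (P' × Unit) ⊕ (Q' × Empty)) (β := (P' × Empty) ⊕ (Q' × Unit))).comp (toBig P' Q' Unit Empty)) u Φ₁) Φ₂)
    (g : UForm P' Q') :
    χ ((g, (1 : UForm Unit Empty)) : Ginf P' Q' Unit Empty) = 1 := by
  have h := UForm.hom_eq_one_of_forall_kV (χ.comp (MonoidHom.inl (UForm P' Q') (UForm Unit Empty)))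
    fun k => factorChar_kV_eq_one E c N hc wOf hw t₀ ht0 hcδ hδ σ hover hTd hJ hfix eP eQ hfac k
  exact DFunLike.congr_fun h g

/-- **THE ARCHIMEDEAN SECTION AT `σ`, PINNED: `s_∞(placeSecJ σ (g, 1)) (Φ₁ ⊠ Φ₂) = (weilRepPair (g, 1) Φ₁) ⊠ Φ₂`** for EVERY `g ∈ U(P′,Q′)`, `Φ₁ ∈ 𝓢(ℝ^{DPIdx P′ Q′ 1 ∅})`,
`Φ₂ ∈ 𝓢(ℝ^{Fin N × {v ≠ σ}})` — Folland's `det^{1/2}`-section of the whole archimedean group, read in the junction frame at the real place `σ`, acts on product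
vectors through the HYPOTHESIS-FREE junction Weil representation `weilRep ∘ toBig` of `U(P′,Q′) × U(1,0)` (★ `isArchWeilDatum_weilRepPair`) with NO character twist
(★ `exists_circle_twist_factorisation_placeSecJ` + §3 `χ (g, 1) = 1`). [cite: Folland1989, Prop. (1.43), §4.2 (4.23), Prop. (4.39)] [cite: KonnoKonno2007, §3.3, Lemma 5.2]
[cite: Weil1964, Chap. III n° 37–38] -/
theorem archSectionRepJ_placeSecJ_inl_tensorPi (g : UForm P' Q') (Φ₁ : SchwartzMap (DPIdx P' Q' Unit Empty → ℝ) ℂ)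
    (Φ₂ : SchwartzMap ((Fin N × {v : {v : InfinitePlace F // v.IsReal} // v ≠ σ}) → ℝ) ℂ) :
    archSectionRepJ E c N hc wOf hw t₀ ht0 hcδ hδ σ hover hTd hJ eP eQ
        (placeSecJ E c N hc wOf hw t₀ ht0 hcδ hδ σ hover hTd hJ hfix eP eQ ((g, (1 : UForm Unit Empty)) : Ginf P' Q' Unit Empty)) (tensorPi Φ₁ Φ₂) =
      tensorPi (((weilRep (α := (P' × Unit) ⊕ (Q' × Empty)) (β := (P' × Empty) ⊕ (Q' × Unit))).comp (toBig P' Q' Unit Empty))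
        ((g, (1 : UForm Unit Empty)) : Ginf P' Q' Unit Empty) Φ₁) Φ₂ := by
  obtain ⟨χ, -, hfac⟩ := exists_circle_twist_factorisation_placeSecJ E c N hc wOf hw t₀ ht0 hcδ hδ σ hover hTd hJ hfix eP eQ
  rw [hfac, charTwist_apply, MonoidHom.comp_apply, factorChar_inl_eq_one E c N hc wOf hw t₀ ht0 hcδ hδ σ hover hTd hJ hfix eP eQ hfac g,
    Circle.coeHom_apply, Circle.coe_one, one_smul]

end Place

end Summit.HodgeConjecture.HodgeConjecture.Cruxes.HLiu418.K2LiuArchSectionPlaceBlock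

end
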